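import Literature.MathematicalPhysics.KineticTheory.VelocityFlipNoise
import Literature.MathematicalPhysics.KineticTheory.LangevinChainNESSProofs
import Mathlib.Probability.Kernel.Invariance

/-!
# Invariant probability measures of a flip semigroup are weak flip steady states
(brick for crux stmt-AtomisticToContinuum-11976 `VanishingNoiseTransfer.VanishingNoiseBound`, line
`fekete-usc-one-length`, stub S3 `stub_noisyPositiveConductance`; worker file, wave 2)

The residual content of S3 (finite-volume Green–Kubo positivity for `L + εS`) is semigroup theory of
the flip-noisy chain, and its first interface with the weak predicate `OscillatorChain.IsFlipSteadyState`
of the crux is the statement proved here, for ANY oscillator chain `P` with `C¹` potentials and ANY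
measurable family of Markov kernels `K_t` (`t ≥ 0`) on phase space satisfying the flip-Dynkin identity
`∫ f dK_t(z,·) - f z = ∫₀ᵗ ∫ (L f + ε S f) dK_s(z,·) ds` on `C_c^∞` (the transition semigroup of
`L + εS`, once constructed, is such a family): every `K`-invariant probability measure under which the
bond currents are integrable is a weak flip steady state (`isFlipSteadyState_of_invariant_of_flipDynkin`).
Proof: integrate the identity at `t = 1` against `μ`; invariance kills the left side and turns the right
side into `∫ (L + εS) f dμ` (Fubini; `(L + εS) f` is bounded and continuous for `f ∈ C_c^∞`). This is the
flip analogue of `LangevinChainSemigroup.IsInvariant.isSteadyState` (tree, `LangevinChainNESSProofs.lean`),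
stated over a bare kernel family because the tree's `LangevinChainSemigroup` interface hard-wires the
flip-FREE generator in its Dynkin field. Also: `continuous_flipGenerator`, `exists_bound_flipGenerator`
(`|L_ε f| ≤ C`), `integral_kernel_invariant` (invariance in integrated form).

No definitions. Registered sub-goal: `helper_flipInvariantIsFlipSteadyState` (the same, fully quantified,
for `pinnedChain ω₂ lam β γ`).
-/

noncomputable section

namespace Summit.AtomisticToContinuum.FouriersLaw.Theorems.VanishingNoiseBound

open MeasureTheory ProbabilityTheory Filter Topology
open scoped NNReal ENNReal ContDiff
open Literature.MathematicalPhysics.KineticTheory.HeatConduction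

section FlipGenerator

variable (P : OscillatorChain) {N : ℕ}

/-- `L_ε f = L f + ε S f` is continuous for `C¹` potentials and `f ∈ C²`. [folklore] -/
theorem continuous_flipGenerator (hU : ContDiff ℝ 1 P.U) (hV : ContDiff ℝ 1 P.V) (T_L T_R ε : ℝ)
    {f : PhaseSpace N → ℝ} (hf : ContDiff ℝ 2 f) :
    Continuous (P.flipGenerator N T_L T_R ε f) := by
  have h1 : Continuous (P.generator N T_L T_R f) := P.continuous_generator hU hV N T_L T_R hf
  have h2 : Continuous fun x : PhaseSpace N => ∑ i : Fin N, (f (momentumFlip i x) - f x) :=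
    continuous_finsetSum _ fun i _ =>
      (hf.continuous.comp (continuous_momentumFlip i)).sub hf.continuous
  have h : P.flipGenerator N T_L T_R ε f =
      fun x => P.generator N T_L T_R f x + ε * ∑ i : Fin N, (f (momentumFlip i x) - f x) := by
    funext x; exact P.flipGenerator_apply N T_L T_R ε f x
  rw [h]
  exact h1.add (continuous_const.mul h2)

/-- `L_ε f` is bounded for `C¹` potentials and `f ∈ C²_c`: `|L f| ≤ C_L` (compact support) and
`|S f| ≤ 2N ‖f‖_∞`. [folklore] -/
theorem exists_bound_flipGenerator (hU : ContDiff ℝ 1 P.U) (hV : ContDiff ℝ 1 P.V) (T_L T_R ε : ℝ)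
    {f : PhaseSpace N → ℝ} (hf : ContDiff ℝ 2 f) (hfc : HasCompactSupport f) :
    ∃ C, ∀ x, ‖P.flipGenerator N T_L T_R ε f x‖ ≤ C := by
  obtain ⟨CL, hCL⟩ := P.exists_bound_generator hU hV N T_L T_R hf hfc
  obtain ⟨Cf, hCf⟩ : ∃ C, ∀ x, ‖f x‖ ≤ C := hf.continuous.bounded_above_of_compact_support hfc
  refine ⟨CL + |ε| * (N * (Cf + Cf)), fun x => ?_⟩
  rw [P.flipGenerator_apply]
  refine (norm_add_le _ _).trans (add_le_add (hCL x) ?_)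
  rw [norm_mul, Real.norm_eq_abs]
  refine mul_le_mul_of_nonneg_left ?_ (abs_nonneg ε)
  calc ‖∑ i : Fin N, (f (momentumFlip i x) - f x)‖
      ≤ ∑ i : Fin N, ‖f (momentumFlip i x) - f x‖ := norm_sum_le _ _
    _ ≤ ∑ _i : Fin N, (Cf + Cf) := Finset.sum_le_sum fun i _ =>
        (norm_sub_le _ _).trans (add_le_add (hCf _) (hCf _))
    _ = N * (Cf + Cf) := by simp; ring

end FlipGenerator

section Invariant

variable {N : ℕ} (K : ℝ≥0 → Kernel (PhaseSpace N) (PhaseSpace N))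

/-- **Invariance in integrated form**: if `μ K_t = μ` then `∫ (∫ g dK_t(z,·)) dμ(z) = ∫ g dμ` for
`g ∈ L¹(μ)`. [folklore] -/
theorem integral_kernel_invariant {μ : Measure (PhaseSpace N)} {t : ℝ≥0}
    (hμ : Kernel.Invariant (K t) μ) {g : PhaseSpace N → ℝ} (hg : Integrable g μ) :
    ∫ z, ∫ y, g y ∂(K t z) ∂μ = ∫ z, g z ∂μ := by
  -- adapted from `LangevinChainSemigroup.IsInvariant.integral_act` (LangevinChainNESSProofs.lean)
  have hint : Integrable g ((K t ∘ₖ Kernel.const Unit μ) ()) := by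
    rw [← Measure.comp_eq_comp_const_apply, hμ.def]
    exact hg
  calc ∫ z, ∫ y, g y ∂(K t z) ∂μ
      = ∫ z, ∫ y, g y ∂(K t z) ∂(Kernel.const Unit μ ()) := by rw [Kernel.const_apply]
    _ = ∫ y, g y ∂((K t ∘ₖ Kernel.const Unit μ) ()) := (Kernel.integral_comp hint).symm
    _ = ∫ y, g y ∂μ := by rw [← Measure.comp_eq_comp_const_apply, hμ.def]

/-- Joint measurability of `(z, s) ↦ ∫ g dK_{s⁺}(z, ·)` for a measurable kernel family. [folklore] -/
theorem stronglyMeasurable_integral_kernel_uncurry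
    (hmeas : Measurable fun p : ℝ≥0 × PhaseSpace N => K p.1 p.2)
    {g : PhaseSpace N → ℝ} (hg : StronglyMeasurable g) :
    StronglyMeasurable fun p : PhaseSpace N × ℝ => ∫ y, g y ∂(K p.2.toNNReal p.1) := by
  let K' : Kernel (ℝ≥0 × PhaseSpace N) (PhaseSpace N) := ⟨fun p => K p.1 p.2, hmeas⟩
  have h1 : StronglyMeasurable fun p : ℝ≥0 × PhaseSpace N => ∫ y, g y ∂(K' p) :=
    hg.integral_kernel (κ := K')
  exact h1.comp_measurable ((measurable_snd.real_toNNReal).prodMk measurable_fst)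

/-- **Invariant probability measures of a flip semigroup are weak flip steady states.** Let `P` be an
oscillator chain with `C¹` potentials, `K_t` (`t ≥ 0`) a measurable family of Markov kernels on the
`N`-particle phase space satisfying the flip-Dynkin identity
`∫ f dK_t(z,·) - f z = ∫₀ᵗ ∫ (L f + ε S f) dK_s(z,·) ds` for all `f ∈ C_c^∞` (e.g. the transition
semigroup of `L + εS`), and `μ` a probability measure with `μ K_t = μ` for all `t` under which the bond
currents are integrable. Then `μ` is a weak flip steady state: `∫ (L + εS) f dμ = 0` on `C_c^∞`
(integrate Dynkin at `t = 1` against `μ`, use invariance on both sides and Fubini).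
[Cuneo–Eckmann–Hairer–Rey-Bellet 2018, §3 p. 7 (generator of the Markov process); Bernardin–Olla 2011,
§2.1] [folklore] -/
theorem isFlipSteadyState_of_invariant_of_flipDynkin [∀ t, IsMarkovKernel (K t)] (P : OscillatorChain)
    (hU : ContDiff ℝ 1 P.U) (hV : ContDiff ℝ 1 P.V) {T_L T_R ε : ℝ}
    (hmeas : Measurable fun p : ℝ≥0 × PhaseSpace N => K p.1 p.2)
    (hdyn : ∀ f : PhaseSpace N → ℝ, ContDiff ℝ ∞ f → HasCompactSupport f →
      ∀ (t : ℝ≥0) (z : PhaseSpace N),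
        ∫ y, f y ∂(K t z) - f z =
          ∫ s in (0 : ℝ)..(t : ℝ), ∫ y, P.flipGenerator N T_L T_R ε f y ∂(K s.toNNReal z))
    {μ : Measure (PhaseSpace N)} [IsProbabilityMeasure μ] (hinv : ∀ t, Kernel.Invariant (K t) μ)
    (hj : ∀ i : Fin N, Integrable (P.bondCurrent N i) μ) :
    P.IsFlipSteadyState N T_L T_R ε μ := by
  refine ⟨inferInstance, fun f hf hfc => ?_, hj⟩
  have hf2 : ContDiff ℝ 2 f := hf.of_le (by norm_cast)
  set g := P.flipGenerator N T_L T_R ε f with hg_def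
  have hgc : Continuous g := continuous_flipGenerator P hU hV T_L T_R ε hf2
  obtain ⟨C, hC⟩ := exists_bound_flipGenerator P hU hV T_L T_R ε hf2 hfc
  have hg_int : Integrable g μ :=
    (integrable_const C).mono' hgc.aestronglyMeasurable (Eventually.of_forall hC)
  -- `f` and `K_1 f` are bounded and integrable
  obtain ⟨Cf, hCf⟩ := hf.continuous.bounded_above_of_compact_support hfc
  have hfsm : StronglyMeasurable f := hf.continuous.stronglyMeasurable
  have hf_int : Integrable f μ :=
    (integrable_const Cf).mono' hfsm.aestronglyMeasurable (Eventually.of_forall hCf)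
  have hKb : ∀ (t : ℝ≥0) {h : PhaseSpace N → ℝ} {B : ℝ}, (∀ x, ‖h x‖ ≤ B) → ∀ z,
      ‖∫ y, h y ∂(K t z)‖ ≤ B := fun t h B hB z =>
    (norm_integral_le_of_norm_le_const (Eventually.of_forall hB)).trans (by simp)
  have hPf_int : Integrable (fun z => ∫ y, f y ∂(K 1 z)) μ :=
    (integrable_const Cf).mono' (hfsm.integral_kernel (κ := K 1)).aestronglyMeasurable
      (Eventually.of_forall (hKb 1 hCf))
  -- the right-hand side of Dynkin's identity on `PhaseSpace N × (0, 1]`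
  set ν : Measure ℝ := volume.restrict (Set.Ioc 0 1) with hν
  have hGint : Integrable (Function.uncurry fun (z : PhaseSpace N) (s : ℝ) =>
      ∫ y, g y ∂(K s.toNNReal z)) (μ.prod ν) :=
    (integrable_const C).mono'
      (stronglyMeasurable_integral_kernel_uncurry K hmeas hgc.stronglyMeasurable).aestronglyMeasurable
      (Eventually.of_forall fun p => hKb _ hC _)
  have hlhs : ∫ z, (∫ y, f y ∂(K 1 z) - f z) ∂μ = 0 := by
    rw [integral_sub hPf_int hf_int, integral_kernel_invariant K (hinv 1) hf_int, sub_self]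
  have hrhs : ∫ z, (∫ s in (0:ℝ)..1, ∫ y, g y ∂(K s.toNNReal z)) ∂μ = ∫ z, g z ∂μ := by
    simp_rw [intervalIntegral.integral_of_le zero_le_one]
    rw [← hν, integral_integral_swap hGint]
    have h : ∀ s : ℝ, ∫ z, ∫ y, g y ∂(K s.toNNReal z) ∂μ = ∫ z, g z ∂μ := fun s =>
      integral_kernel_invariant K (hinv _) hg_int
    simp_rw [h]
    rw [integral_const, measureReal_restrict_apply_univ, Real.volume_real_Ioc_of_le zero_le_one,
      sub_zero, one_smul]
  calc ∫ x, g x ∂μ = ∫ z, (∫ s in (0:ℝ)..1, ∫ y, g y ∂(K s.toNNReal z)) ∂μ := hrhs.symm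
    _ = ∫ z, (∫ y, f y ∂(K 1 z) - f z) ∂μ :=
        integral_congr_ae (Eventually.of_forall fun z => by
          have h := hdyn f hf hfc 1 z
          simp only [NNReal.coe_one] at h
          exact h.symm)
    _ = 0 := hlhs

/-- **Registered sub-goal `helper_flipInvariantIsFlipSteadyState`** of stmt-AtomisticToContinuum-11976 (brick for
stub S3 `stub_noisyPositiveConductance`): `isFlipSteadyState_of_invariant_of_flipDynkin` for the pinned
anharmonic chain `pinnedChain ω₂ lam β γ` (smooth potentials), fully quantified and notation-free: every
invariant probability measure, with integrable bond currents, of a measurable Markov kernel family satisfying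
the flip-Dynkin identity for `L + εS` is an `OscillatorChain.IsFlipSteadyState`. [folklore] -/
theorem helper_flipInvariantIsFlipSteadyState : ∀ (ω₂ lam β γ : ℝ) (N : ℕ) (T_L T_R ε : ℝ) (K : NNReal → ProbabilityTheory.Kernel (Literature.MathematicalPhysics.KineticTheory.HeatConduction.PhaseSpace N) (Literature.MathematicalPhysics.KineticTheory.HeatConduction.PhaseSpace N)), (∀ t : NNReal, ProbabilityTheory.IsMarkovKernel (K t)) → Measurable (fun p : NNReal × Literature.MathematicalPhysics.KineticTheory.HeatConduction.PhaseSpace N => K p.1 p.2) → (∀ f : Literature.MathematicalPhysics.KineticTheory.HeatConduction.PhaseSpace N → ℝ, ContDiff ℝ ((⊤ : ℕ∞) : WithTop ℕ∞) f → HasCompactSupport f → ∀ (t : NNReal) (z : Literature.MathematicalPhysics.KineticTheory.HeatConduction.PhaseSpace N), MeasureTheory.integral (K t z) (fun y => f y) - f z = intervalIntegral (fun s : ℝ => MeasureTheory.integral (K s.toNNReal z) (fun y => (Literature.MathematicalPhysics.KineticTheory.HeatConduction.pinnedChain ω₂ lam β γ).flipGenerator N T_L T_R ε f y)) 0 (t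 : ℝ) MeasureTheory.volume) → ∀ μ : MeasureTheory.Measure (Literature.MathematicalPhysics.KineticTheory.HeatConduction.PhaseSpace N), MeasureTheory.IsProbabilityMeasure μ → (∀ t : NNReal, ProbabilityTheory.Kernel.Invariant (K t) μ) → (∀ i : Fin N, MeasureTheory.Integrable ((Literature.MathematicalPhysics.KineticTheory.HeatConduction.pinnedChain ω₂ lam β γ).bondCurrent N i) μ) → (Literature.MathematicalPhysics.KineticTheory.HeatConduction.pinnedChain ω₂ lam β γ).IsFlipSteadyState N T_L T_R ε μ := by
  intro ω₂ lam β γ N T_L T_R ε K hK hmeas hdyn μ hμ hinv hj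
  haveI := hK
  haveI := hμ
  exact isFlipSteadyState_of_invariant_of_flipDynkin K (pinnedChain ω₂ lam β γ)
    (pinnedChain_contDiff_U ω₂ lam β γ) (pinnedChain_contDiff_V ω₂ lam β γ) hmeas hdyn hinv hj

end Invariant

end Summit.AtomisticToContinuum.FouriersLaw.Theorems.VanishingNoiseBound

end
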